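import Summits.ValiantsHypothesis.ValiantsHypothesis.Theorems.KPlusLogSqLawTropicalBTopHeavyCoreMultiRaise

/-!
# Route «KPlusLogSqLaw», crux `TropicalB` (stmt-ValiantsHypothesis-19771) — THE TRANSFER LAW IN ARC-FREE SUM FORM, and
# THE (2,2)→(1,3) TRANSFER LAW FOR TWO-VALUED `A` (every arrangement, every `m`)

HONEST FRAMING.  Helper file (cell `pub-symmetroid`, seat val-sym-trop-p1 g23, 2026-08-29; `--supports stmt-ValiantsHypothesis-19771 --as
helper`), sequel of …TopHeavyCoreMultiRaise (same seat).  Census-STRUCTURE laws of the κ-programme (3-body obstructions on dominant terms of an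
arbitrary dominance design); nothing here bounds `TropicalB` in its window and nothing bears on `WeakLifting`, DoorA26 / DoorA34, `MatrixDescartes`
(stmt-ValiantsHypothesis-18050) or VP ≠ VNP.  CENSUS NOTE (honest): every law here shares the `C`-histogram `c₀^{m−1}c₄` with CORE LAW C, whose
«`C` latest» region is the largest of the family, so NO new deficient census cell follows — the content is the all-arrangement structure law.

1. `transfer_of_sums` — the one-jump transfer scheme with its three arc lemmas replaced by ARC-FREE SUM CONDITIONS (what `exists_arc`,
   `exists_arc_good` and the covering number actually deliver).  `P_C` latest, `λC ≡ c₀` off one column `c`, `d c₀ ≤ d (λC ·)`,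
   `d c₀ < d (λA ·), d (λB ·)`; `s` raised (`d (λA s) < d (λB s)`).  Write `r x = d (λB x) − d (λA x)`, `surA x = d (λA x) − d c₀`.  IF
   (B1) some raised `b` has `d (λB b) − d c₀ ≥` every deficit `−r j`;
   (A2) for every column set `U ≠ univ` and `j ∈ U` with `s ∉ U ∖ {j}`:  `Σ_{U ∖ {j}} r ≤ Σ_{Uᶜ} surA`;
   (A3) for some column set `L` missing a lowered column: for every `U ≠ univ`, `j ∈ U`, `j ≠ s` with `j ∉ L` or `Uᶜ ⊄ L`:  `r j ≤ Σ_{Uᶜ} surA`;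
   THEN `P_A, P_B, P_C` are not all dominant.  (`P_B` earlier: unprimed arc avoiding `b`, (B1).  `P_A` earlier and `σA⁻¹σB s ≠ s`: unprimed arc
   avoiding `s` (`exists_arc`), (A2).  `P_A` earlier and `s` unmoved: primed arc through `c` chosen by `exists_arc_good` against `L`, its end is
   moved hence `≠ s`, (A3).)  `multiRaise_transfer` is the instance «(A1) ⇒ (A2), (A3) with `L = ∅`».
2. `transfer_twoValued` — **THE (2,2)→(1,3) TRANSFER LAW FOR TWO-VALUED `A`**: classes `d c₀ < d c₁ < d c₂ < d c₃`; `λA = c₁` on a column set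
   `P`, `c₂` off `P`; `λB = c₃` at `s`, `c₁` on a set `Q ∌ s` with `#Q = #P + 1`, `c₂` elsewhere (histograms `A = c₁^a c₂^{m−a}`,
   `B = c₁^{a+1} c₂^{m−a−2} c₃ = A − 2c₂ + c₁ + c₃`, `a = #P`, ANY arrangement: `P`, `Q`, `s` unrestricted otherwise); `P_C` as above, latest.
   Then the three are not all dominant — for EVERY `m` and `a`.  (A2) holds by COUNTING: off `s`, `r = (d c₂ − d c₁)·([· ∈ P] − [· ∈ Q])` and
   `#Q = #P + 1`, so `Σ_{U∖{j}} r ≤ (d c₂ − d c₁)·#(Uᶜ ∖ P) ≤ Σ_{Uᶜ} surA`; (A3) with `L = P`; (B1) with `b = s`.  INSTANCES: `a = 0` is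
   `core_law_Cprime` (…TopHeavyCoreTransfer), `a = m − 2` is CORE LAW C (`core_law_C`, …TopHeavyCoreArc), `a = 1` contains `two_raised_transfer`
   (…MultiRaise) and the aligned / (1,3)-raise arrangements; `2 ≤ a ≤ m − 3` is NEW (located beforehand: ktight, `(m, a) = (5, 2)`, 9/9 random
   «`C` latest» exponent vectors infeasible in both slope orders of `A`, `B`, seat folder tools/kt/coreA2.py).  This closes the lineage's
   «(2,2)→(1,3) TRANSFER CONJECTURE» (memo HOME/val-sym-trop-p1/g21/CORE-LAW-C-g21.md §6) for every `A` with values in `{c₁, c₂}`; `A` with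
   `c₃`-columns stays open (several large raises).
[this cell; combinatorics folklore]
-/

set_option linter.dupNamespace false
set_option autoImplicit false

namespace Summit.ValiantsHypothesis.ValiantsHypothesis.Theorems.KPlusLogSqLaw.TopHeavyCore

open Summit.ValiantsHypothesis.ValiantsHypothesis.Theorems.MatrixDescartes.Negative
open scoped BigOperators
open Finset

variable {m K : ℕ}

/-! ## 1. The transfer law in arc-free sum form -/

/-- **TRANSFER LAW, ARC-FREE SUM FORM.**  See the module docstring, item 1. [this cell] -/
theorem transfer_of_sums (d : Fin K → ℕ) (v ε : Fin m → Fin m → Fin K → ℤ)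
    {c₀ : Fin K} {σA σB σC : Equiv.Perm (Fin m)} {lA lB lC : Fin m → Fin K} {c s : Fin m}
    (hlC : ∀ x, x ≠ c → lC x = c₀) (hCge : ∀ x, d c₀ ≤ d (lC x)) (hlowA : ∀ x, d c₀ < d (lA x)) (hlowB : ∀ x, d c₀ < d (lB x))
    {θA θB θC : ℤ} (hA : IsDominant d v ε θA (σA, lA)) (hB : IsDominant d v ε θB (σB, lB)) (hC : IsDominant d v ε θC (σC, lC))
    (hAC : θA < θC) (hBC : θB < θC) (hs : d (lA s) < d (lB s))
    (hB1 : ∃ b, d (lA b) < d (lB b) ∧ ∀ j, (d (lA j) : ℤ) - d (lB j) ≤ (d (lB b) : ℤ) - d c₀)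
    (hA2 : ∀ (U : Finset (Fin m)) (j : Fin m), j ∈ U → U ≠ univ → s ∉ U.erase j →
      ∑ x ∈ U.erase j, ((d (lB x) : ℤ) - d (lA x)) ≤ ∑ x ∈ Uᶜ, ((d (lA x) : ℤ) - d c₀))
    (hA3 : ∃ L : Finset (Fin m), (∃ y, y ∉ L ∧ d (lB y) < d (lA y)) ∧
      ∀ (U : Finset (Fin m)) (j : Fin m), j ∈ U → U ≠ univ → j ≠ s → (j ∉ L ∨ ∃ x, x ∉ U ∧ x ∉ L) →
        (d (lB j) : ℤ) - d (lA j) ≤ ∑ x ∈ Uᶜ, ((d (lA x) : ℤ) - d c₀)) : False := by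
  classical
  obtain ⟨L, ⟨q, hqL, hq⟩, hA3⟩ := hA3
  -- `P_A ≠ P_B`, `θA ≠ θB`, `m ≥ 2`
  have hABne : ((σA, lA) : Equiv.Perm (Fin m) × (Fin m → Fin K)) ≠ (σB, lB) := by
    intro h
    have : lA q = lB q := by rw [(Prod.mk.inj h).2]
    rw [this] at hq; exact lt_irrefl _ hq
  have hAB : θA ≠ θB := by
    rintro rfl
    exact lt_asymm (hA.2 _ (Ne.symm hABne) hB.1) (hB.2 _ hABne hA.1)
  have hqs : q ≠ s := by rintro rfl; exact lt_asymm hq hs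
  have hm : 2 ≤ m := by
    have h := card_le_card (subset_univ ({q, s} : Finset (Fin m)))
    rw [card_pair hqs, card_univ, Fintype.card_fin] at h; exact h
  have hsubA : ∀ U : Finset (Fin m), ∑ x ∈ Uᶜ, ((d (lA x) : ℤ) - d c₀) = ∑ x ∈ Uᶜ, (d (lA x) : ℤ) - ∑ _x ∈ Uᶜ, (d c₀ : ℤ) :=
    fun U => Finset.sum_sub_distrib _ _
  rcases lt_or_gt_of_ne hAB with hlt | hgt
  · -- CASE `P_A` earlier: the lowered column `q` is moved by `σA⁻¹σB`
    have hqτ : (σA⁻¹ * σB) q ≠ q := moved_of_lowered d v ε hA hB hlt hq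
    by_cases hsτ : (σA⁻¹ * σB) s = s
    · -- `s` unmoved: PRIMED family `P = σC⁻¹σA`, `τ = σB⁻¹σA`, arc chosen against `L` by `exists_arc_good`
      obtain ⟨hfix, hcyc⟩ := cycle_CX d v ε hAC hA hC c hlC hlowA hm
      set P : Equiv.Perm (Fin m) := σC⁻¹ * σA with hPdef
      set τ : Equiv.Perm (Fin m) := σB⁻¹ * σA with hτdef
      have hτinv : τ = (σA⁻¹ * σB)⁻¹ := by rw [hτdef, mul_inv_rev, inv_inv]
      have hqτ' : τ q ≠ q := by
        rw [hτinv, Ne, Equiv.Perm.inv_eq_iff_eq]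
        exact fun h => hqτ h.symm
      have hsτ' : τ s = s := by
        rw [hτinv, Equiv.Perm.inv_eq_iff_eq]; exact hsτ.symm
      obtain ⟨Uf, hUF⟩ := exists_arcFamily P τ hfix hcyc
      obtain ⟨j, hj, hcU, hgood⟩ := exists_arc_good P τ hfix hcyc Uf hUF L q c hqL hqτ'
      obtain ⟨hjU, hfirst, hcard, hstart, hstep, -, -⟩ := hUF j hj
      set U := Uf j with hUdef
      have hUne : U ≠ univ := by rintro h; rw [h, card_univ, Fintype.card_fin] at hcard; exact lt_irrefl _ hcard
      have hjs : j ≠ s := fun h => hj (by rw [h]; exact hsτ')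
      have hinj := oneJump_injective (σA := σB) (σB := σA) (σC := σC) hPdef hτdef hfirst hstart hstep
      refine core_of_oneJump d v ε hm hlC hCge hlowB hlowA hB hA hC hBC hAC (Ne.symm hAB) U j hjU hcU hUne hinj
        (fun h => absurd hlt (lt_asymm h)) ?_
      intro _
      have h1 := hA3 U j hjU hUne hjs hgood
      rw [hsubA U] at h1
      linarith
    · -- `s` moved: UNPRIMED family `P = σC⁻¹σB`, `τ = σA⁻¹σB`, arc through `c` avoiding `s`
      obtain ⟨hfix, hcyc⟩ := cycle_CX d v ε hBC hB hC c hlC hlowB hm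
      set P : Equiv.Perm (Fin m) := σC⁻¹ * σB with hPdef
      set τ : Equiv.Perm (Fin m) := σA⁻¹ * σB with hτdef
      obtain ⟨Uf, hUF⟩ := exists_arcFamily P τ hfix hcyc
      obtain ⟨j, hj, hcU, hsU⟩ := exists_arc P τ hfix hcyc Uf hUF s c hsτ
      obtain ⟨hjU, hfirst, hcard, hstart, hstep, -, -⟩ := hUF j hj
      set U := Uf j with hUdef
      have hUne : U ≠ univ := by rintro h; rw [h, card_univ, Fintype.card_fin] at hcard; exact lt_irrefl _ hcard
      have hinj := oneJump_injective hPdef hτdef hfirst hstart hstep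
      refine core_of_oneJump d v ε hm hlC hCge hlowA hlowB hA hB hC hAC hBC hAB U j hjU hcU hUne hinj ?_
        (fun h => absurd hlt (lt_asymm h))
      intro _
      have hsS : s ∉ U.erase j := by
        rw [mem_erase]
        rintro ⟨h1', h2'⟩
        rcases hsU with h | h
        · exact h h2'
        · exact h1' h
      have h1 := hA2 U j hjU hUne hsS
      rw [Finset.sum_sub_distrib, hsubA U] at h1
      linarith
  · -- CASE `P_B` earlier: the raised column `b` of (B1) is moved; UNPRIMED family, arc through `c` avoiding `b`
    obtain ⟨b, hbr, hbud⟩ := hB1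
    have hbτ : (σA⁻¹ * σB) b ≠ b := moved_of_raised d v ε hA hB hgt hbr
    obtain ⟨hfix, hcyc⟩ := cycle_CX d v ε hBC hB hC c hlC hlowB hm
    set P : Equiv.Perm (Fin m) := σC⁻¹ * σB with hPdef
    set τ : Equiv.Perm (Fin m) := σA⁻¹ * σB with hτdef
    obtain ⟨Uf, hUF⟩ := exists_arcFamily P τ hfix hcyc
    obtain ⟨j, hj, hcU, hbU⟩ := exists_arc P τ hfix hcyc Uf hUF b c hbτ
    obtain ⟨hjU, hfirst, hcard, hstart, hstep, -, -⟩ := hUF j hj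
    set U := Uf j with hUdef
    have hUne : U ≠ univ := by rintro h; rw [h, card_univ, Fintype.card_fin] at hcard; exact lt_irrefl _ hcard
    have hinj := oneJump_injective hPdef hτdef hfirst hstart hstep
    refine core_of_oneJump d v ε hm hlC hCge hlowA hlowB hA hB hC hAC hBC hAB U j hjU hcU hUne hinj
      (fun h => absurd hgt (lt_asymm h)) ?_
    intro _
    have hlowB' : ∑ _x ∈ Uᶜ, (d c₀ : ℤ) ≤ ∑ x ∈ Uᶜ, (d (lB x) : ℤ) :=
      Finset.sum_le_sum fun x _ => by exact_mod_cast (hlowB x).le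
    rcases hbU with hbU | hbj
    · have h1 : (d (lB b) : ℤ) - d c₀ ≤ ∑ x ∈ Uᶜ, (d (lB x) : ℤ) - ∑ _x ∈ Uᶜ, (d c₀ : ℤ) := by
        rw [← Finset.sum_sub_distrib]
        refine Finset.single_le_sum (f := fun x => (d (lB x) : ℤ) - d c₀) (fun x _ => ?_) (mem_compl.mpr hbU)
        have : (d c₀ : ℤ) ≤ d (lB x) := by exact_mod_cast (hlowB x).le
        linarith
      have h2 := hbud j
      linarith
    · subst hbj
      have h2 : (d (lA b) : ℤ) < d (lB b) := by exact_mod_cast hbr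
      linarith

/-! ## 2. The (2,2)→(1,3) transfer law for two-valued `A` -/

/-- bookkeeping: for `j ∈ U`, the size of a set splits over `U ∖ {j}`, `{j}`, `Uᶜ`. [folklore] -/
theorem card_split_erase (U S : Finset (Fin m)) {j : Fin m} (hjU : j ∈ U) :
    (S.card : ℤ) = ((U.erase j ∩ S).card : ℤ) + (if j ∈ S then 1 else 0) + ((Uᶜ ∩ S).card : ℤ) := by
  classical
  have h1 : S = (U ∩ S) ∪ (Uᶜ ∩ S) := by
    ext x; simp only [mem_union, mem_inter, mem_compl]; tauto
  have h2 : Disjoint (U ∩ S) (Uᶜ ∩ S) := by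
    rw [Finset.disjoint_left]
    intro x hx hx'
    exact (mem_compl.mp (mem_inter.mp hx').1) (mem_inter.mp hx).1
  have h3 : U ∩ S = (U.erase j ∩ S) ∪ (if j ∈ S then {j} else ∅) := by
    ext x
    simp only [mem_union, mem_inter, mem_erase]
    by_cases hjS : j ∈ S
    · rw [if_pos hjS, mem_singleton]
      constructor
      · rintro ⟨hxU, hxS⟩
        by_cases hxj : x = j
        · exact Or.inr hxj
        · exact Or.inl ⟨⟨hxj, hxU⟩, hxS⟩
      · rintro (⟨⟨-, hxU⟩, hxS⟩ | rfl)
        · exact ⟨hxU, hxS⟩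
        · exact ⟨hjU, hjS⟩
    · rw [if_neg hjS]
      simp only [Finset.notMem_empty, or_false]
      constructor
      · rintro ⟨hxU, hxS⟩
        exact ⟨⟨fun h => hjS (h ▸ hxS), hxU⟩, hxS⟩
      · rintro ⟨⟨-, hxU⟩, hxS⟩; exact ⟨hxU, hxS⟩
  have h4 : Disjoint (U.erase j ∩ S) (if j ∈ S then {j} else ∅) := by
    rw [Finset.disjoint_left]
    intro x hx hx'
    split_ifs at hx' with hjS
    · rw [mem_singleton] at hx'
      exact (mem_erase.mp (mem_inter.mp hx).1).1 hx'
    · simp at hx'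
  have e : S.card = (U.erase j ∩ S).card + (if j ∈ S then ({j} : Finset (Fin m)) else ∅).card + (Uᶜ ∩ S).card := by
    conv_lhs => rw [h1, card_union_of_disjoint h2, h3, card_union_of_disjoint h4]
  rw [e]
  push_cast
  split_ifs <;> simp

/-- **THE (2,2)→(1,3) TRANSFER LAW FOR TWO-VALUED `A`** (every arrangement, every `m`).  See the module docstring, item 2. [this cell] -/
theorem transfer_twoValued (d : Fin K → ℕ) (v ε : Fin m → Fin m → Fin K → ℤ)
    {c₀ c₁ c₂ c₃ : Fin K} (h01 : d c₀ < d c₁) (h12 : d c₁ < d c₂) (h23 : d c₂ < d c₃)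
    {σA σB σC : Equiv.Perm (Fin m)} {lA lB lC : Fin m → Fin K} {s c : Fin m} {P Q : Finset (Fin m)}
    (hcardQ : Q.card = P.card + 1) (hsQ : s ∉ Q)
    (hlA : ∀ x, lA x = if x ∈ P then c₁ else c₂)
    (hlB : ∀ x, lB x = if x = s then c₃ else if x ∈ Q then c₁ else c₂)
    (hlC : ∀ x, x ≠ c → lC x = c₀) (hCge : ∀ x, d c₀ ≤ d (lC x))
    {θA θB θC : ℤ} (hA : IsDominant d v ε θA (σA, lA)) (hB : IsDominant d v ε θB (σB, lB)) (hC : IsDominant d v ε θC (σC, lC))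
    (hAC : θA < θC) (hBC : θB < θC) : False := by
  classical
  -- integer exponents and tables
  set e₀ : ℤ := (d c₀ : ℤ) with he₀
  set e₁ : ℤ := (d c₁ : ℤ) with he₁
  set e₂ : ℤ := (d c₂ : ℤ) with he₂
  set e₃ : ℤ := (d c₃ : ℤ) with he₃
  have h01z : e₀ < e₁ := by rw [he₀, he₁]; exact_mod_cast h01
  have h12z : e₁ < e₂ := by rw [he₁, he₂]; exact_mod_cast h12
  have h23z : e₂ < e₃ := by rw [he₂, he₃]; exact_mod_cast h23
  have hAz : ∀ x, (d (lA x) : ℤ) = if x ∈ P then e₁ else e₂ := fun x => by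
    rw [hlA x]; split_ifs <;> rfl
  have hBz : ∀ x, (d (lB x) : ℤ) = if x = s then e₃ else if x ∈ Q then e₁ else e₂ := fun x => by
    rw [hlB x]; split_ifs <;> rfl
  have hAge : ∀ x, e₁ ≤ d (lA x) := fun x => by rw [hAz x]; split_ifs <;> linarith
  have hAle : ∀ x, (d (lA x) : ℤ) ≤ e₂ := fun x => by rw [hAz x]; split_ifs <;> linarith
  have hBge : ∀ x, e₁ ≤ d (lB x) := fun x => by rw [hBz x]; split_ifs <;> linarith
  have hlowA : ∀ x, d c₀ < d (lA x) := fun x => by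
    have := hAge x; rw [he₁] at this; exact_mod_cast (show (d c₀ : ℤ) < d (lA x) by linarith)
  have hlowB : ∀ x, d c₀ < d (lB x) := fun x => by
    have := hBge x; rw [he₁] at this; exact_mod_cast (show (d c₀ : ℤ) < d (lB x) by linarith)
  -- off `s`, the raise is `(e₂ − e₁)·([· ∈ P] − [· ∈ Q])`; the `A`-surplus is `≥ (e₂ − e₁)·[· ∉ P]` and `≥ 0`
  have hr : ∀ x, x ≠ s → (d (lB x) : ℤ) - d (lA x) =
      (e₂ - e₁) * ((if x ∈ P then (1 : ℤ) else 0) - (if x ∈ Q then (1 : ℤ) else 0)) := by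
    intro x hxs
    rw [hAz x, hBz x, if_neg hxs]
    split_ifs <;> ring
  have hsur : ∀ x, (e₂ - e₁) * (if x ∈ P then (0 : ℤ) else 1) ≤ (d (lA x) : ℤ) - d c₀ := by
    intro x; rw [hAz x, ← he₀]; split_ifs <;> linarith
  -- a lowered column: some `y ∈ Q \ P` (since `#Q > #P`)
  obtain ⟨y, hyQ, hyP⟩ : ∃ y, y ∈ Q ∧ y ∉ P := by
    by_contra h
    push Not at h
    have : Q.card ≤ P.card := card_le_card fun x hx => h x hx
    omega
  have hys : y ≠ s := fun h => hsQ (h ▸ hyQ)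
  have hylow : d (lB y) < d (lA y) := by
    have h1 : (d (lB y) : ℤ) = e₁ := by rw [hBz y, if_neg hys, if_pos hyQ]
    have h2 : (d (lA y) : ℤ) = e₂ := by rw [hAz y, if_neg hyP]
    exact_mod_cast (show (d (lB y) : ℤ) < d (lA y) by rw [h1, h2]; exact h12z)
  have hsP : (d (lA s) : ℤ) ≤ e₂ := hAle s
  have hBs : (d (lB s) : ℤ) = e₃ := by rw [hBz s, if_pos rfl]
  refine transfer_of_sums d v ε (s := s) hlC hCge hlowA hlowB hA hB hC hAC hBC
    (by exact_mod_cast (show (d (lA s) : ℤ) < d (lB s) by rw [hBs]; linarith)) ⟨s, ?_, fun j => ?_⟩ ?_ ⟨P, ⟨y, hyP, hylow⟩, ?_⟩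
  · exact_mod_cast (show (d (lA s) : ℤ) < d (lB s) by rw [hBs]; linarith)
  · -- (B1) with `b = s`: every deficit is `≤ e₂ − e₁ < e₃ − e₀`
    rw [hBs, ← he₀]
    have h1 := hAle j
    have h2 := hBge j
    linarith
  · -- (A2) by counting
    intro U j hjU hUne hsS
    have hsum1 : ∑ x ∈ U.erase j, ((d (lB x) : ℤ) - d (lA x)) =
        (e₂ - e₁) * (((U.erase j ∩ P).card : ℤ) - ((U.erase j ∩ Q).card : ℤ)) := by
      rw [Finset.sum_congr rfl fun x hx => hr x (fun h => hsS (h ▸ hx)), ← Finset.mul_sum, Finset.sum_sub_distrib,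
        Finset.sum_boole, Finset.sum_boole, Finset.filter_mem_eq_inter, Finset.filter_mem_eq_inter]
    have hsum2 : (e₂ - e₁) * (((Uᶜ).card : ℤ) - ((Uᶜ ∩ P).card : ℤ)) ≤ ∑ x ∈ Uᶜ, ((d (lA x) : ℤ) - d c₀) := by
      have h := Finset.sum_le_sum fun x (_ : x ∈ Uᶜ) => hsur x
      rw [← Finset.mul_sum] at h
      have e : ∑ x ∈ Uᶜ, (if x ∈ P then (0 : ℤ) else 1) = ((Uᶜ).card : ℤ) - ((Uᶜ ∩ P).card : ℤ) := by
        have e1 : ∑ x ∈ Uᶜ, (if x ∈ P then (0 : ℤ) else 1) = ∑ x ∈ Uᶜ, ((1 : ℤ) - (if x ∈ P then (1 : ℤ) else 0)) :=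
          Finset.sum_congr rfl fun x _ => by split_ifs <;> simp
        rw [e1, Finset.sum_sub_distrib, Finset.sum_boole, Finset.filter_mem_eq_inter, Finset.sum_const]
        simp
      rw [e] at h; exact h
    -- counting: `#(U∖{j} ∩ P) − #(U∖{j} ∩ Q) ≤ #Uᶜ − #(Uᶜ ∩ P)`
    have cP := card_split_erase U P hjU
    have cQ := card_split_erase U Q hjU
    have hQc : ((Uᶜ ∩ Q).card : ℤ) ≤ ((Uᶜ).card : ℤ) := by exact_mod_cast card_le_card inter_subset_left
    have hcard : (Q.card : ℤ) = P.card + 1 := by exact_mod_cast hcardQ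
    have hjP : (if j ∈ P then (1 : ℤ) else 0) ≥ 0 := by split_ifs <;> norm_num
    have hjQ : (if j ∈ Q then (1 : ℤ) else 0) ≤ 1 := by split_ifs <;> norm_num
    have hδ : (0 : ℤ) < e₂ - e₁ := by linarith
    rw [hsum1]
    refine le_trans ?_ hsum2
    apply mul_le_mul_of_nonneg_left _ hδ.le
    linarith
  · -- (A3) with `L = P`
    intro U j hjU hUne hjs hgood
    have h0 : (0 : ℤ) ≤ ∑ x ∈ Uᶜ, ((d (lA x) : ℤ) - d c₀) :=
      Finset.sum_nonneg fun x _ => by have := hlowA x; have : (d c₀ : ℤ) ≤ d (lA x) := (by exact_mod_cast this.le); linarith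
    rcases hgood with hjP | ⟨x, hxU, hxP⟩
    · -- `j ∉ P`, `j ≠ s`: not raised
      rw [hr j hjs, if_neg hjP]
      have : (e₂ - e₁) * ((0 : ℤ) - (if j ∈ Q then (1 : ℤ) else 0)) ≤ 0 := by
        have hδ : (0 : ℤ) ≤ e₂ - e₁ := by linarith
        have : ((0 : ℤ) - (if j ∈ Q then (1 : ℤ) else 0)) ≤ 0 := by split_ifs <;> norm_num
        nlinarith
      linarith
    · -- a column `x ∉ P` off the arc: its surplus `e₂ − e₀` covers the raise at `j`
      have h1 : (e₂ - e₁) * 1 ≤ ∑ x ∈ Uᶜ, ((d (lA x) : ℤ) - d c₀) := by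
        refine le_trans ?_ (Finset.single_le_sum (f := fun x => (d (lA x) : ℤ) - d c₀) (fun x _ => ?_) (mem_compl.mpr hxU))
        · have := hsur x; rw [if_neg hxP] at this; exact this
        · have := hlowA x; have : (d c₀ : ℤ) ≤ d (lA x) := (by exact_mod_cast this.le); linarith
      rw [hr j hjs]
      have h2 : ((if j ∈ P then (1 : ℤ) else 0) - (if j ∈ Q then (1 : ℤ) else 0)) ≤ 1 := by split_ifs <;> norm_num
      have hδ : (0 : ℤ) ≤ e₂ - e₁ := by linarith
      nlinarith

end Summit.ValiantsHypothesis.ValiantsHypothesis.Theorems.KPlusLogSqLaw.TopHeavyCore
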